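import Summits.Ventures.LatticeQCDFlow.Scoring.SU2TorusWilsonLoopCharacterIntegral
import Summits.Ventures.LatticeQCDFlow.Scoring.SU2TorusPlaquette
import HarnessLib

/-!
# SU(2) on the 2-torus: the Wilson-loop insertion `∫ a₀(W_{R×T}) e^{−βS} dHaar^{⊗E}` as a Bessel-type series

HONEST FRAMING: exact (Metropolis-corrected) sampling algorithms for lattice gauge theory;
figures of merit are autocorrelation/cost numbers at stated couplings and volumes; no
continuum-physics claim.

Venture `LatticeQCDFlow` (cell pub-lqcd), sub-topic `Scoring`; FANOUT row 5 (`s0-sun-a`), GEN-11.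
NEW WORK of the cell (placement rule); towards the lead's NOT-TYPED item 'Wilson loops larger than one
plaquette' (oracle X02's `wilson_loops`) for theory-2's Wilson weight on `(ℤ/L)²` (`L ≥ 1`, `β ≥ 0`).  For a
corner `(i,j)` and `1 ≤ R ≤ L`, `1 ≤ T ≤ L` let `W = W_{R×T}` be the holonomy around the boundary of the
lattice rectangle `[i,i+R) × [j,j+T)` (`SU2TorusRectangleMerging`; a contractible `R × T` Wilson loop when
`R, T ≤ L − 1`) and `c_n(β) = e^{−2β}(I_n(2β) − I_{n+2}(2β))` the Haar character coefficients of the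
plaquette weight.

* `integral_su2a0_loop_mul_exp_neg_wilsonAction_eq_tsum` — the character expansion of the loop insertion
  (`SU2PlaquetteSeriesFubiniWeighted`, the loop trace being a bounded measurable observable);
* `loop_insertion_term_two` — the terms, evaluated by
  `SU2TorusWilsonLoopCharacterIntegral.integral_su2a0_loop_mul_prod_su2Character`;
* **`hasSum_integral_su2a0_loop_mul_exp_neg_wilsonAction_two`** — only the assignments '`n` on the
  rectangle, `n+1` off it' and '`n+1` on the rectangle, `n` off it' survive:
  `∫ a₀(W) e^{−βS} dHaar^{⊗E} = ½ Σ_n [c_n^{RT} c_{n+1}^{L²−RT} ((n+2)/(n+1))^{RT−1} (n+2)^{−L²}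
                                    + c_{n+1}^{RT} c_n^{L²−RT} ((n+1)/(n+2))^{RT−1} (n+1)^{−L²}]`.

The normalised expectation `⟨½ tr W_{R×T}⟩` is the next file.  Nothing is cited as a fact; no `def`.
-/

noncomputable section

open Real MeasureTheory Set Function Finset Polynomial.Chebyshev
open Literature.MathematicalPhysics.QuantumFieldTheory Literature.MathematicalPhysics.QuantumLattice
open Literature.Analysis.FunctionSpaces
open Summit.Ventures.LatticeQCDFlow.Exactness
open Summit.Ventures.LatticeQCDFlow.Theory2.Lattice

namespace Summit.Ventures.LatticeQCDFlow.Scoring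

variable {L : ℕ} [NeZero L]

/-! ## §1. The character expansion of the loop insertion -/

omit [NeZero L] in
/-- The loop holonomy `W_{R×T}` is a continuous function of the configuration. -/
theorem continuous_loop (i j : ZMod L) (R T : ℕ) :
    Continuous fun V : GaugeConfig 2 L (Matrix.specialUnitaryGroup (Fin 2) ℂ) =>
      ((List.range R).map fun a : ℕ => V (![i + a, j], 0)).prod *
        ((List.range T).map fun b : ℕ => V (![i + R, j + b], 1)).prod *
        (((List.range R).map fun a : ℕ => V (![i + a, j + T], 0)).prod)⁻¹ *
        (((List.range T).map fun b : ℕ => V (![i, j + b], 1)).prod)⁻¹ := by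
  refine ((Continuous.mul (Continuous.mul ?_ ?_) (Continuous.inv ?_)).mul (Continuous.inv ?_)) <;>
    exact continuous_list_prod _ fun k _ => continuous_apply _

/-- **The loop insertion, expanded in characters**: for `β ≥ 0`,
`∫ a₀(W) e^{−βS(U)} dHaar^{⊗E} = Σ'_{x : plaquettes → ℕ} (∏_p c_{x_p}(β)) · ∫ a₀(W) ∏_p χ_{x_p}(U_p) dHaar^{⊗E}`,
the series converging absolutely. -/
theorem integral_su2a0_loop_mul_exp_neg_wilsonAction_eq_tsum {β : ℝ} (hβ : 0 ≤ β) (i j : ZMod L) (R T : ℕ) :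
    (Summable fun x : Plaquette 2 L → ℕ => (∏ p, Real.exp (-(2 * β)) *
        (besselI (x p) (2 * β) - besselI (x p + 2) (2 * β))) *
        ∫ V, su2a0 (((List.range R).map fun a : ℕ => V (![i + a, j], 0)).prod *
            ((List.range T).map fun b : ℕ => V (![i + R, j + b], 1)).prod *
            (((List.range R).map fun a : ℕ => V (![i + a, j + T], 0)).prod)⁻¹ *
            (((List.range T).map fun b : ℕ => V (![i, j + b], 1)).prod)⁻¹) *
          ∏ p : Plaquette 2 L, (U ℝ (x p)).eval (su2a0 (plaquetteHolonomy V p.1 p.2.1.1 p.2.1.2))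
          ∂(Measure.pi fun _ : Edge 2 L => haarProbability (Matrix.specialUnitaryGroup (Fin 2) ℂ))) ∧
    ∫ V, su2a0 (((List.range R).map fun a : ℕ => V (![i + a, j], 0)).prod *
            ((List.range T).map fun b : ℕ => V (![i + R, j + b], 1)).prod *
            (((List.range R).map fun a : ℕ => V (![i + a, j + T], 0)).prod)⁻¹ *
            (((List.range T).map fun b : ℕ => V (![i, j + b], 1)).prod)⁻¹) *
        Real.exp (-β * wilsonAction (fundamentalRep (Fin 2)) V)
        ∂(Measure.pi fun _ : Edge 2 L => haarProbability (Matrix.specialUnitaryGroup (Fin 2) ℂ)) =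
      ∑' x : Plaquette 2 L → ℕ, (∏ p, Real.exp (-(2 * β)) *
        (besselI (x p) (2 * β) - besselI (x p + 2) (2 * β))) *
        ∫ V, su2a0 (((List.range R).map fun a : ℕ => V (![i + a, j], 0)).prod *
            ((List.range T).map fun b : ℕ => V (![i + R, j + b], 1)).prod *
            (((List.range R).map fun a : ℕ => V (![i + a, j + T], 0)).prod)⁻¹ *
            (((List.range T).map fun b : ℕ => V (![i, j + b], 1)).prod)⁻¹) *
          ∏ p : Plaquette 2 L, (U ℝ (x p)).eval (su2a0 (plaquetteHolonomy V p.1 p.2.1.1 p.2.1.2))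
          ∂(Measure.pi fun _ : Edge 2 L => haarProbability (Matrix.specialUnitaryGroup (Fin 2) ℂ)) := by
  haveI := secondCountableTopology_su2
  have ham : ∀ p : Plaquette 2 L, Measurable fun V : GaugeConfig 2 L (Matrix.specialUnitaryGroup (Fin 2) ℂ) =>
      su2a0 (plaquetteHolonomy V p.1 p.2.1.1 p.2.1.2) :=
    fun p => continuous_su2a0.measurable.comp
      (Literature.MathematicalPhysics.QuantumFieldTheory.measurable_plaquetteHolonomy p.1 p.2.1.1 p.2.1.2)
  have ha : ∀ (p : Plaquette 2 L) (V : GaugeConfig 2 L (Matrix.specialUnitaryGroup (Fin 2) ℂ)),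
      su2a0 (plaquetteHolonomy V p.1 p.2.1.1 p.2.1.2) ∈ Icc (-1 : ℝ) 1 :=
    fun p V => abs_le.mp (abs_su2a0_le_one _)
  have hgm : Measurable fun V : GaugeConfig 2 L (Matrix.specialUnitaryGroup (Fin 2) ℂ) =>
      su2a0 (((List.range R).map fun a : ℕ => V (![i + a, j], 0)).prod *
        ((List.range T).map fun b : ℕ => V (![i + R, j + b], 1)).prod *
        (((List.range R).map fun a : ℕ => V (![i + a, j + T], 0)).prod)⁻¹ *
        (((List.range T).map fun b : ℕ => V (![i, j + b], 1)).prod)⁻¹) :=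
    (continuous_su2a0.comp (continuous_loop i j R T)).measurable
  have h := integral_mul_prod_plaqWeight_eq_tsum_fintype
    (Measure.pi fun _ : Edge 2 L => haarProbability (Matrix.specialUnitaryGroup (Fin 2) ℂ)) hβ
    (fun (p : Plaquette 2 L) (V : GaugeConfig 2 L (Matrix.specialUnitaryGroup (Fin 2) ℂ)) =>
      su2a0 (plaquetteHolonomy V p.1 p.2.1.1 p.2.1.2)) ham ha _ hgm (fun V => abs_su2a0_le_one _)
  refine ⟨h.1, ?_⟩
  rw [← h.2]
  refine integral_congr_ae (Filter.Eventually.of_forall fun V => ?_)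
  beta_reduce
  rw [exp_neg_mul_wilsonAction_su2 β V]

/-! ## §2. The surviving assignments -/

/-- **The expansion term of the loop insertion** at `x : plaquettes → ℕ` is `(∏_p c_{x_p})` times the
inserted character integral of the base-site assignment `s ↦ x(s,(0,1))`. -/
theorem loop_insertion_term_two (β : ℝ) (i j : ZMod L) {R T : ℕ} (hR : 1 ≤ R) (hRL : R ≤ L)
    (hT : 1 ≤ T) (hTL : T ≤ L) (x : Plaquette 2 L → ℕ) :
    (∏ p, Real.exp (-(2 * β)) * (besselI (x p) (2 * β) - besselI (x p + 2) (2 * β))) *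
        ∫ V, su2a0 (((List.range R).map fun a : ℕ => V (![i + a, j], 0)).prod *
            ((List.range T).map fun b : ℕ => V (![i + R, j + b], 1)).prod *
            (((List.range R).map fun a : ℕ => V (![i + a, j + T], 0)).prod)⁻¹ *
            (((List.range T).map fun b : ℕ => V (![i, j + b], 1)).prod)⁻¹) *
          ∏ p : Plaquette 2 L, (U ℝ (x p)).eval (su2a0 (plaquetteHolonomy V p.1 p.2.1.1 p.2.1.2))
          ∂(Measure.pi fun _ : Edge 2 L => haarProbability (Matrix.specialUnitaryGroup (Fin 2) ℂ)) =
      (∏ p, Real.exp (-(2 * β)) * (besselI (x p) (2 * β) - besselI (x p + 2) (2 * β))) *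
        (if (∀ a < R, ∀ b < T, x (![i + a, j + b], ⟨((0 : Fin 2), (1 : Fin 2)), by decide⟩) =
            x (![i, j], ⟨((0 : Fin 2), (1 : Fin 2)), by decide⟩)) then
          (1 / 2) * (((x (![i, j], ⟨((0 : Fin 2), (1 : Fin 2)), by decide⟩) : ℝ) + 2) /
              ((x (![i, j], ⟨((0 : Fin 2), (1 : Fin 2)), by decide⟩) : ℝ) + 1)) ^ (R * T - 1) *
              (if (∀ s, s ∉ (range R ×ˢ range T).image (fun q : ℕ × ℕ => (![i + q.1, j + q.2] : Site 2 L)) →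
                  x (s, ⟨((0 : Fin 2), (1 : Fin 2)), by decide⟩) =
                    x (![i, j], ⟨((0 : Fin 2), (1 : Fin 2)), by decide⟩) + 1) then
                ((((x (![i, j], ⟨((0 : Fin 2), (1 : Fin 2)), by decide⟩) : ℝ) + 2) ^ (L ^ 2)))⁻¹ else 0) +
            (1 / 2) * (if x (![i, j], ⟨((0 : Fin 2), (1 : Fin 2)), by decide⟩) = 0 then 0 else
              ((x (![i, j], ⟨((0 : Fin 2), (1 : Fin 2)), by decide⟩) : ℝ) /
                  ((x (![i, j], ⟨((0 : Fin 2), (1 : Fin 2)), by decide⟩) : ℝ) + 1)) ^ (R * T - 1) *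
                (if (∀ s, s ∉ (range R ×ˢ range T).image (fun q : ℕ × ℕ => (![i + q.1, j + q.2] : Site 2 L)) →
                    x (s, ⟨((0 : Fin 2), (1 : Fin 2)), by decide⟩) =
                      x (![i, j], ⟨((0 : Fin 2), (1 : Fin 2)), by decide⟩) - 1) then
                  ((((x (![i, j], ⟨((0 : Fin 2), (1 : Fin 2)), by decide⟩) : ℝ)) ^ (L ^ 2)))⁻¹ else 0))
        else 0) := by
  congr 1
  have hint : (fun V : GaugeConfig 2 L (Matrix.specialUnitaryGroup (Fin 2) ℂ) =>
      su2a0 (((List.range R).map fun a : ℕ => V (![i + a, j], 0)).prod *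
          ((List.range T).map fun b : ℕ => V (![i + R, j + b], 1)).prod *
          (((List.range R).map fun a : ℕ => V (![i + a, j + T], 0)).prod)⁻¹ *
          (((List.range T).map fun b : ℕ => V (![i, j + b], 1)).prod)⁻¹) *
        ∏ p : Plaquette 2 L, (U ℝ (x p)).eval (su2a0 (plaquetteHolonomy V p.1 p.2.1.1 p.2.1.2))) =
      fun V => su2a0 (((List.range R).map fun a : ℕ => V (![i + a, j], 0)).prod *
          ((List.range T).map fun b : ℕ => V (![i + R, j + b], 1)).prod *
          (((List.range R).map fun a : ℕ => V (![i + a, j + T], 0)).prod)⁻¹ *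
          (((List.range T).map fun b : ℕ => V (![i, j + b], 1)).prod)⁻¹) *
        ∏ s : Site 2 L, (U ℝ ((fun s : Site 2 L => x (s, ⟨((0 : Fin 2), (1 : Fin 2)), by decide⟩)) s)).eval
          (su2a0 (plaquetteHolonomy V s 0 1)) := by
    funext V
    rw [prod_plaquette_two]
  rw [hint, integral_su2a0_loop_mul_prod_su2Character i j hR hRL hT hTL]

/-! ## §3. The loop insertion as a series over `ℕ` -/

/-- **`∫ a₀(W_{R×T}) e^{−βS} dHaar^{⊗E} = ½ Σ_n [c_n^{RT} c_{n+1}^{L²−RT} ((n+2)/(n+1))^{RT−1} (n+2)^{−L²}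
+ c_{n+1}^{RT} c_n^{L²−RT} ((n+1)/(n+2))^{RT−1} (n+1)^{−L²}]`** (`β ≥ 0`, `1 ≤ R ≤ L`, `1 ≤ T ≤ L`,
`c_n = e^{−2β}(I_n(2β) − I_{n+2}(2β))`), as a `HasSum`: only the assignments '`n` on the rectangle,
`n + 1` off it' and '`n + 1` on the rectangle, `n` off it' contribute. -/
theorem hasSum_integral_su2a0_loop_mul_exp_neg_wilsonAction_two {β : ℝ} (hβ : 0 ≤ β) (i j : ZMod L)
    {R T : ℕ} (hR : 1 ≤ R) (hRL : R ≤ L) (hT : 1 ≤ T) (hTL : T ≤ L) :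
    HasSum (fun n : ℕ => (1 / 2) *
        ((Real.exp (-(2 * β)) * (besselI n (2 * β) - besselI (n + 2) (2 * β))) ^ (R * T) *
            (Real.exp (-(2 * β)) * (besselI (n + 1) (2 * β) - besselI (n + 1 + 2) (2 * β))) ^ (L ^ 2 - R * T) *
            ((((n : ℝ) + 2) / ((n : ℝ) + 1)) ^ (R * T - 1)) * ((((n : ℝ) + 2) ^ (L ^ 2)))⁻¹ +
          (Real.exp (-(2 * β)) * (besselI (n + 1) (2 * β) - besselI (n + 1 + 2) (2 * β))) ^ (R * T) *
            (Real.exp (-(2 * β)) * (besselI n (2 * β) - besselI (n + 2) (2 * β))) ^ (L ^ 2 - R * T) *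
            ((((n : ℝ) + 1) / ((n : ℝ) + 2)) ^ (R * T - 1)) * ((((n : ℝ) + 1) ^ (L ^ 2)))⁻¹))
      (∫ V, su2a0 (((List.range R).map fun a : ℕ => V (![i + a, j], 0)).prod *
            ((List.range T).map fun b : ℕ => V (![i + R, j + b], 1)).prod *
            (((List.range R).map fun a : ℕ => V (![i + a, j + T], 0)).prod)⁻¹ *
            (((List.range T).map fun b : ℕ => V (![i, j + b], 1)).prod)⁻¹) *
        Real.exp (-β * wilsonAction (fundamentalRep (Fin 2)) V)
        ∂(Measure.pi fun _ : Edge 2 L => haarProbability (Matrix.specialUnitaryGroup (Fin 2) ℂ))) := by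
  obtain ⟨hsum, hN⟩ := integral_su2a0_loop_mul_exp_neg_wilsonAction_eq_tsum (L := L) hβ i j R T
  -- abbreviations: the plane, the rectangle, the corner plaquette, the coefficients, the base-site assignment
  set pl : {p : Fin 2 × Fin 2 // p.1 < p.2} := ⟨((0 : Fin 2), (1 : Fin 2)), by decide⟩ with hpl
  set A := (range R ×ˢ range T).image (fun q : ℕ × ℕ => (![i + q.1, j + q.2] : Site 2 L)) with hA
  set p₀ : Plaquette 2 L := (![i, j], pl) with hp₀
  set c : ℕ → ℝ := fun n => Real.exp (-(2 * β)) * (besselI n (2 * β) - besselI (n + 2) (2 * β)) with hc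
  have hc0 : ∀ n, 0 ≤ c n := fun n => charCoeff_nonneg hβ n
  have hcorner : (![i, j] : Site 2 L) ∈ A := by
    have := mem_rect i j (R := R) (T := T) (a := 0) (b := 0) (by omega) (by omega)
    rwa [Nat.cast_zero, add_zero, add_zero] at this
  -- the two surviving families of terms
  set Tp : (Plaquette 2 L → ℕ) → ℝ := fun x => (∏ p, c (x p)) *
    (if (∀ a < R, ∀ b < T, x (![i + a, j + b], pl) = x p₀) then
      (1 / 2) * (((x p₀ : ℝ) + 2) / ((x p₀ : ℝ) + 1)) ^ (R * T - 1) *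
        (if (∀ s, s ∉ A → x (s, pl) = x p₀ + 1) then ((((x p₀ : ℝ) + 2) ^ (L ^ 2)))⁻¹ else 0)
     else 0) with hTp
  set Tm : (Plaquette 2 L → ℕ) → ℝ := fun x => (∏ p, c (x p)) *
    (if (∀ a < R, ∀ b < T, x (![i + a, j + b], pl) = x p₀) then
      (1 / 2) * (if x p₀ = 0 then 0 else
        ((x p₀ : ℝ) / ((x p₀ : ℝ) + 1)) ^ (R * T - 1) *
          (if (∀ s, s ∉ A → x (s, pl) = x p₀ - 1) then ((((x p₀ : ℝ)) ^ (L ^ 2)))⁻¹ else 0))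
     else 0) with hTm
  have hT : ∀ x : Plaquette 2 L → ℕ,
      (∏ p, Real.exp (-(2 * β)) * (besselI (x p) (2 * β) - besselI (x p + 2) (2 * β))) *
      ∫ V, su2a0 (((List.range R).map fun a : ℕ => V (![i + a, j], 0)).prod *
            ((List.range T).map fun b : ℕ => V (![i + R, j + b], 1)).prod *
            (((List.range R).map fun a : ℕ => V (![i + a, j + T], 0)).prod)⁻¹ *
            (((List.range T).map fun b : ℕ => V (![i, j + b], 1)).prod)⁻¹) *
        ∏ p : Plaquette 2 L, (U ℝ (x p)).eval (su2a0 (plaquetteHolonomy V p.1 p.2.1.1 p.2.1.2))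
        ∂(Measure.pi fun _ : Edge 2 L => haarProbability (Matrix.specialUnitaryGroup (Fin 2) ℂ)) =
      Tp x + Tm x := by
    intro x
    rw [loop_insertion_term_two β i j hR hRL hT hTL x, hTp, hTm, hc]
    simp only
    split_ifs <;> ring
  simp_rw [hT] at hsum hN
  have hprod0 : ∀ x : Plaquette 2 L → ℕ, 0 ≤ ∏ p, c (x p) := fun x => Finset.prod_nonneg fun p _ => hc0 _
  have hTp0 : ∀ x, 0 ≤ Tp x := by
    intro x
    rw [hTp]
    refine mul_nonneg (hprod0 x) ?_
    split_ifs <;> positivity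
  have hTm0 : ∀ x, 0 ≤ Tm x := by
    intro x
    rw [hTm]
    refine mul_nonneg (hprod0 x) ?_
    split_ifs <;> positivity
  have hTps : Summable Tp :=
    Summable.of_nonneg_of_le hTp0 (fun x => le_add_of_nonneg_right (hTm0 x)) hsum
  have hTms : Summable Tm :=
    Summable.of_nonneg_of_le hTm0 (fun x => le_add_of_nonneg_left (hTp0 x)) hsum
  -- the surviving assignments
  set g₁ : ℕ → (Plaquette 2 L → ℕ) := fun n p => if p.1 ∈ A then n else n + 1 with hg₁
  set g₂ : ℕ → (Plaquette 2 L → ℕ) := fun n p => if p.1 ∈ A then n + 1 else n with hg₂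
  have hg₁p₀ : ∀ n, g₁ n p₀ = n := fun n => by simp only [hg₁, hp₀]; exact if_pos hcorner
  have hg₂p₀ : ∀ n, g₂ n p₀ = n + 1 := fun n => by simp only [hg₂, hp₀]; exact if_pos hcorner
  have hg₁inj : Injective g₁ := fun n n' h => by
    have := congrFun h p₀
    rwa [hg₁p₀, hg₁p₀] at this
  have hg₂inj : Injective g₂ := fun n n' h => by
    have := congrFun h p₀
    rw [hg₂p₀, hg₂p₀] at this
    exact Nat.succ_injective this
  -- membership of a base site in the rectangle gives its value
  have hmemA : ∀ {s : Site 2 L}, s ∈ A → ∃ a b : ℕ, a < R ∧ b < T ∧ s = ![i + a, j + b] := by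
    intro s hs
    obtain ⟨q, hq, rfl⟩ := Finset.mem_image.mp hs
    rw [Finset.mem_product, Finset.mem_range, Finset.mem_range] at hq
    exact ⟨q.1, q.2, hq.1, hq.2, rfl⟩
  have hsuppTp : support Tp ⊆ Set.range g₁ := by
    intro x hx
    rw [mem_support, hTp] at hx
    simp only at hx
    have hC : ∀ a < R, ∀ b < T, x (![i + a, j + b], pl) = x p₀ := by
      by_contra h
      rw [if_neg h, mul_zero] at hx
      exact hx rfl
    rw [if_pos hC] at hx
    have hout : ∀ s, s ∉ A → x (s, pl) = x p₀ + 1 := by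
      by_contra h
      rw [if_neg h, mul_zero, mul_zero] at hx
      exact hx rfl
    refine ⟨x p₀, funext fun p => ?_⟩
    rw [plaquette_two_eq p, hg₁]
    by_cases hp : p.1 ∈ A
    · simp only [if_pos hp]
      obtain ⟨a, b, ha, hb, h1⟩ := hmemA hp
      rw [h1]
      exact (hC a ha b hb).symm
    · simp only [if_neg hp]
      exact (hout p.1 hp).symm
  have hsuppTm : support Tm ⊆ Set.range g₂ := by
    intro x hx
    rw [mem_support, hTm] at hx
    simp only at hx
    have hC : ∀ a < R, ∀ b < T, x (![i + a, j + b], pl) = x p₀ := by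
      by_contra h
      rw [if_neg h, mul_zero] at hx
      exact hx rfl
    rw [if_pos hC] at hx
    have h0 : x p₀ ≠ 0 := by
      intro h
      rw [if_pos h, mul_zero, mul_zero] at hx
      exact hx rfl
    rw [if_neg h0] at hx
    have hout : ∀ s, s ∉ A → x (s, pl) = x p₀ - 1 := by
      by_contra h
      rw [if_neg h, mul_zero, mul_zero, mul_zero] at hx
      exact hx rfl
    refine ⟨x p₀ - 1, funext fun p => ?_⟩
    rw [plaquette_two_eq p, hg₂]
    by_cases hp : p.1 ∈ A
    · simp only [if_pos hp]
      obtain ⟨a, b, ha, hb, h1⟩ := hmemA hp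
      rw [h1, hC a ha b hb]
      omega
    · simp only [if_neg hp]
      exact (hout p.1 hp).symm
  -- the values on the surviving assignments
  have hg₁in : ∀ n, ∀ a < R, ∀ b < T, g₁ n (![i + a, j + b], pl) = g₁ n p₀ := by
    intro n a ha b hb
    rw [hg₁p₀]
    simp only [hg₁]
    exact if_pos (mem_rect i j ha hb)
  have hg₂in : ∀ n, ∀ a < R, ∀ b < T, g₂ n (![i + a, j + b], pl) = g₂ n p₀ := by
    intro n a ha b hb
    rw [hg₂p₀]
    simp only [hg₂]
    exact if_pos (mem_rect i j ha hb)
  have hg₁out : ∀ n, ∀ s, s ∉ A → g₁ n (s, pl) = g₁ n p₀ + 1 := by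
    intro n s hs
    rw [hg₁p₀]
    simp only [hg₁]
    exact if_neg hs
  have hg₂out : ∀ n, ∀ s, s ∉ A → g₂ n (s, pl) = g₂ n p₀ - 1 := by
    intro n s hs
    rw [hg₂p₀, Nat.add_sub_cancel]
    simp only [hg₂]
    exact if_neg hs
  have hTpg : ∀ n : ℕ, Tp (g₁ n) = (1 / 2) * (c n ^ (R * T) * c (n + 1) ^ (L ^ 2 - R * T) *
      ((((n : ℝ) + 2) / ((n : ℝ) + 1)) ^ (R * T - 1)) * ((((n : ℝ) + 2) ^ (L ^ 2)))⁻¹) := by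
    intro n
    rw [hTp]
    simp only
    rw [if_pos (hg₁in n), if_pos (hg₁out n), hg₁p₀,
      show (∏ p, c (g₁ n p)) = c n ^ (R * T) * c (n + 1) ^ (L ^ 2 - R * T) from
        prod_rect_piecewise c i j hRL hTL n (n + 1)]
    ring
  have hTmg : ∀ n : ℕ, Tm (g₂ n) = (1 / 2) * (c (n + 1) ^ (R * T) * c n ^ (L ^ 2 - R * T) *
      ((((n : ℝ) + 1) / ((n : ℝ) + 2)) ^ (R * T - 1)) * ((((n : ℝ) + 1) ^ (L ^ 2)))⁻¹) := by
    intro n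
    rw [hTm]
    simp only
    rw [if_pos (hg₂in n), hg₂p₀, if_neg (Nat.succ_ne_zero n), if_pos, 
      show (∏ p, c (g₂ n p)) = c (n + 1) ^ (R * T) * c n ^ (L ^ 2 - R * T) from
        prod_rect_piecewise c i j hRL hTL (n + 1) n]
    · push_cast
      ring
    · intro s hs
      rw [← hg₂p₀ n]
      exact hg₂out n s hs
  -- assemble
  have h1 : HasSum (Tp ∘ g₁) (∑' x, Tp x) := by
    rw [← hg₁inj.tsum_eq hsuppTp]
    exact (hTps.comp_injective hg₁inj).hasSum
  have h2 : HasSum (Tm ∘ g₂) (∑' x, Tm x) := by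
    rw [← hg₂inj.tsum_eq hsuppTm]
    exact (hTms.comp_injective hg₂inj).hasSum
  have h12 := h1.add h2
  rw [← hTps.tsum_add hTms, ← hN] at h12
  refine h12.congr_fun fun n => ?_
  simp only [Function.comp_apply, hTpg, hTmg, hc]
  ring

end Summit.Ventures.LatticeQCDFlow.Scoring
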